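import Literature.NumberTheory.LFunctions.WeilOddThetaVector
import Literature.NumberTheory.LFunctions.DeBruijnPhiSecondDeriv
import HarnessLib

/-!
# A ratio bound for Riemann's kernel `Φ′` (crux OddBartaFloor, line Sketch, stub phiRatio)

For `1/2 ≤ s₁ ≤ s₂` we prove the termwise-derived ratio bound
`|Φ′(s₂)| ≤ 2 exp(−(2πe^{2s₁} − 13/2)(s₂ − s₁)) |Φ′(s₁)|` for `Φ′ = weilThetaPhiDeriv`
(`weilThetaPhiDeriv s = deBruijnPhiDeriv (s/2)`), i.e. a log-derivative lower bound
`−(log |Φ′|)′ ≳ 2πe^{2s}` in integrated form. By the one-series form `deBruijnPhiDeriv_eq_tsum`,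
`|Φ′(s)| = e^{s/2} ∑_n p(y_n(s)) e^{−y_n(s)}` with `p(y) = 15y − 30y² + 8y³` and
`y_n(s) = π(n+1)²e^{2s} ≥ πe ≥ 8` for `s ≥ 1/2` (all terms nonnegative). Termwise, with
`y₂ = y₁e^{2(s₂−s₁)} ≥ y₁ ≥ 8`: `p(y₂) ≤ 8y₂³ ≤ 2e^{6(s₂−s₁)}p(y₁)` (as `p(y₁) ≥ 4y₁³`) and
`y₂ − y₁ ≥ 2y₁(s₂ − s₁) ≥ 2πe^{2s₁}(s₂ − s₁)`; summing and multiplying by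
`e^{s₂/2} = e^{s₁/2}e^{(s₂−s₁)/2}` gives the claim. Elementary; no published source needed.
[folklore]
-/

set_option linter.dupNamespace false

noncomputable section

open Set MeasureTheory Filter Complex
open scoped Real Topology ComplexConjugate ArithmeticFunction.vonMangoldt ENNReal

namespace Summit.RiemannHypothesis.RiemannHypothesis.Theorems.OddBartaFloor

open Literature.NumberTheory.LFunctions

/-- Numerics: `8 ≤ π e^{2s}` for `s ≥ 1/2` (`π > 3`, `e > 2.718`). [folklore] -/
private theorem stub_phiRatio_eight_le {s : ℝ} (hs : 1 / 2 ≤ s) : 8 ≤ π * rexp (2 * s) := by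
  have h1 : rexp 1 ≤ rexp (2 * s) := Real.exp_le_exp.2 (by linarith)
  have h2 := Real.exp_one_gt_d9
  have h3 := Real.pi_gt_three
  calc (8 : ℝ) ≤ 3 * 2.7182818283 := by norm_num
    _ ≤ π * rexp (2 * s) := mul_le_mul h3.le (h2.le.trans h1) (by norm_num) Real.pi_pos.le

/-- The polynomial factor `p(y) = 15y − 30y² + 8y³` satisfies `4y³ ≤ p(y) ≤ 8y³` for `y ≥ 8`.
[folklore] -/
private theorem stub_phiRatio_poly {y : ℝ} (hy : 8 ≤ y) :
    4 * y ^ 3 ≤ 15 * y + -30 * y ^ 2 + 8 * y ^ 3 + 0 * y ^ 4 ∧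
      15 * y + -30 * y ^ 2 + 8 * y ^ 3 + 0 * y ^ 4 ≤ 8 * y ^ 3 := by
  have h0 : 0 ≤ y := by linarith
  constructor
  · nlinarith [mul_nonneg (mul_nonneg h0 h0) (by linarith : (0 : ℝ) ≤ y - 8)]
  · nlinarith [mul_nonneg h0 (by linarith : (0 : ℝ) ≤ 2 * y - 1)]

/-- Algebraic core of the termwise bound: for `y ≥ 8`, `r ≥ 1` and `a ≤ yr − y`,
`p(yr)e^{−yr} ≤ 2 r³ e^{−a} · p(y)e^{−y}`. [folklore] -/
private theorem stub_phiRatio_core {y r a : ℝ} (hy : 8 ≤ y) (hr : 1 ≤ r) (ha : a ≤ y * r - y) :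
    (15 * (y * r) + -30 * (y * r) ^ 2 + 8 * (y * r) ^ 3 + 0 * (y * r) ^ 4) * rexp (-(y * r)) ≤
      2 * (r ^ 3 * rexp (-a)) *
        ((15 * y + -30 * y ^ 2 + 8 * y ^ 3 + 0 * y ^ 4) * rexp (-y)) := by
  have h0 : 0 ≤ y := by linarith
  have hyr : 8 ≤ y * r := hy.trans (le_mul_of_one_le_right h0 hr)
  obtain ⟨hp1, -⟩ := stub_phiRatio_poly hy
  obtain ⟨-, hp3⟩ := stub_phiRatio_poly hyr
  have hexp : rexp (-(y * r)) ≤ rexp (-a) * rexp (-y) := by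
    rw [← Real.exp_add]
    exact Real.exp_le_exp.2 (by linarith)
  have h4 : 0 ≤ 4 * y ^ 3 := mul_nonneg (by norm_num) (pow_nonneg h0 3)
  have h2r : (0 : ℝ) ≤ 2 * r ^ 3 := mul_nonneg (by norm_num) (pow_nonneg (by linarith) 3)
  calc (15 * (y * r) + -30 * (y * r) ^ 2 + 8 * (y * r) ^ 3 + 0 * (y * r) ^ 4) * rexp (-(y * r))
      ≤ (2 * r ^ 3 * (15 * y + -30 * y ^ 2 + 8 * y ^ 3 + 0 * y ^ 4)) * (rexp (-a) * rexp (-y)) := by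
        refine mul_le_mul ?_ hexp (Real.exp_pos _).le (mul_nonneg h2r (h4.trans hp1))
        calc _ ≤ 8 * (y * r) ^ 3 := hp3
          _ = 2 * r ^ 3 * (4 * y ^ 3) := by ring
          _ ≤ 2 * r ^ 3 * (15 * y + -30 * y ^ 2 + 8 * y ^ 3 + 0 * y ^ 4) :=
              mul_le_mul_of_nonneg_left hp1 h2r
    _ = 2 * (r ^ 3 * rexp (-a)) * ((15 * y + -30 * y ^ 2 + 8 * y ^ 3 + 0 * y ^ 4) * rexp (-y)) := by
        ring

/-- **Termwise ratio bound** for the series of `Φ′` (`deBruijnPhiDeriv_eq_tsum`, `x = e^{2s}`):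
for `1/2 ≤ s₁ ≤ s₂` and every `n`,
`T_n(e^{2s₂}) ≤ 2 exp((6 − 2πe^{2s₁})(s₂ − s₁)) T_n(e^{2s₁})`. [folklore] -/
private theorem stub_phiRatio_term {s₁ s₂ : ℝ} (h1 : 1 / 2 ≤ s₁) (h12 : s₁ ≤ s₂) (n : ℕ) :
    phiPolyTerm 15 (-30) 8 0 (rexp (2 * s₂)) n ≤
      2 * rexp ((6 - 2 * π * rexp (2 * s₁)) * (s₂ - s₁)) *
        phiPolyTerm 15 (-30) 8 0 (rexp (2 * s₁)) n := by
  have hd : 0 ≤ s₂ - s₁ := sub_nonneg.2 h12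
  have h8 : 8 ≤ π * rexp (2 * s₁) := stub_phiRatio_eight_le h1
  have hyx : π * rexp (2 * s₁) ≤ thetaFreq (rexp (2 * s₁)) n :=
    pi_mul_le_thetaFreq (Real.exp_pos _).le n
  have hr : 1 + 2 * (s₂ - s₁) ≤ rexp (2 * (s₂ - s₁)) := by
    have := Real.add_one_le_exp (2 * (s₂ - s₁))
    linarith
  have hy₂ : thetaFreq (rexp (2 * s₂)) n =
      thetaFreq (rexp (2 * s₁)) n * rexp (2 * (s₂ - s₁)) := by
    simp only [thetaFreq]
    rw [show 2 * s₂ = 2 * s₁ + 2 * (s₂ - s₁) by ring, Real.exp_add]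
    ring
  have he : rexp ((6 - 2 * π * rexp (2 * s₁)) * (s₂ - s₁)) =
      rexp (2 * (s₂ - s₁)) ^ 3 * rexp (-(2 * π * rexp (2 * s₁) * (s₂ - s₁))) := by
    rw [← Real.exp_nat_mul, ← Real.exp_add]
    congr 1
    push_cast
    ring
  have ha : 2 * π * rexp (2 * s₁) * (s₂ - s₁) ≤
      thetaFreq (rexp (2 * s₁)) n * rexp (2 * (s₂ - s₁)) - thetaFreq (rexp (2 * s₁)) n := by
    nlinarith [mul_le_mul_of_nonneg_left hr (by linarith : (0 : ℝ) ≤ thetaFreq (rexp (2 * s₁)) n),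
      mul_le_mul_of_nonneg_right hyx (by linarith : (0 : ℝ) ≤ 2 * (s₂ - s₁))]
  simp only [phiPolyTerm]
  rw [hy₂, he]
  exact stub_phiRatio_core (h8.trans hyx) (by linarith) ha

/-- **Ratio bound for Riemann's kernel `Φ′ = weilThetaPhiDeriv`**: for `1/2 ≤ s₁ ≤ s₂`,
`|Φ′(s₂)| ≤ 2 exp(−(2πe^{2s₁} − 13/2)(s₂ − s₁)) |Φ′(s₁)|` (the termwise bound `stub_phiRatio_term`
summed over the one-series form `deBruijnPhiDeriv_eq_tsum`, all of whose terms are nonnegative for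
`s ≥ 1/2`, times `e^{s₂/2} = e^{s₁/2}e^{(s₂−s₁)/2}`). [folklore] -/
theorem stub_phiRatio :
    ∀ s₁ s₂ : ℝ, 1 / 2 ≤ s₁ → s₁ ≤ s₂ →
      |weilThetaPhiDeriv s₂| ≤
        2 * rexp (-(2 * π * rexp (2 * s₁) - 13 / 2) * (s₂ - s₁)) * |weilThetaPhiDeriv s₁| := by
  intro s₁ s₂ h1 h12
  have hS : ∀ s : ℝ, 1 / 2 ≤ s → Summable (phiPolyTerm 15 (-30) 8 0 (rexp (2 * s))) ∧
      |weilThetaPhiDeriv s| = rexp (s / 2) * ∑' n, phiPolyTerm 15 (-30) 8 0 (rexp (2 * s)) n := by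
    intro s hs
    have hnn : ∀ n, 0 ≤ phiPolyTerm 15 (-30) 8 0 (rexp (2 * s)) n := fun n => by
      have hy8 : 8 ≤ thetaFreq (rexp (2 * s)) n :=
        (stub_phiRatio_eight_le hs).trans (pi_mul_le_thetaFreq (Real.exp_pos _).le n)
      have h4 : (0 : ℝ) ≤ 4 * thetaFreq (rexp (2 * s)) n ^ 3 :=
        mul_nonneg (by norm_num) (pow_nonneg (by linarith) 3)
      simp only [phiPolyTerm]
      exact mul_nonneg (h4.trans (stub_phiRatio_poly hy8).1) (Real.exp_pos _).le
    refine ⟨summable_phiPolyTerm _ _ _ _ (Real.exp_pos _), ?_⟩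
    have e4 : rexp (4 * (s / 2)) = rexp (2 * s) := by
      congr 1
      ring
    rw [weilThetaPhiDeriv, deBruijnPhiDeriv_eq_tsum, e4, abs_neg, abs_mul,
      abs_of_pos (Real.exp_pos _), abs_of_nonneg (tsum_nonneg hnn)]
  obtain ⟨hs₁, e₁⟩ := hS s₁ h1
  obtain ⟨hs₂, e₂⟩ := hS s₂ (h1.trans h12)
  have hsum := hs₂.tsum_le_tsum (fun n => stub_phiRatio_term h1 h12 n) (hs₁.mul_left _)
  rw [tsum_mul_left] at hsum
  have hexp : rexp (s₂ / 2) * rexp ((6 - 2 * π * rexp (2 * s₁)) * (s₂ - s₁)) =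
      rexp (-(2 * π * rexp (2 * s₁) - 13 / 2) * (s₂ - s₁)) * rexp (s₁ / 2) := by
    rw [← Real.exp_add, ← Real.exp_add]
    congr 1
    ring
  rw [e₁, e₂]
  calc rexp (s₂ / 2) * ∑' n, phiPolyTerm 15 (-30) 8 0 (rexp (2 * s₂)) n
      ≤ rexp (s₂ / 2) * (2 * rexp ((6 - 2 * π * rexp (2 * s₁)) * (s₂ - s₁)) *
          ∑' n, phiPolyTerm 15 (-30) 8 0 (rexp (2 * s₁)) n) :=
        mul_le_mul_of_nonneg_left hsum (Real.exp_pos _).le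
    _ = 2 * rexp (-(2 * π * rexp (2 * s₁) - 13 / 2) * (s₂ - s₁)) *
          (rexp (s₁ / 2) * ∑' n, phiPolyTerm 15 (-30) 8 0 (rexp (2 * s₁)) n) := by
        linear_combination (2 * ∑' n, phiPolyTerm 15 (-30) 8 0 (rexp (2 * s₁)) n) * hexp

end Summit.RiemannHypothesis.RiemannHypothesis.Theorems.OddBartaFloor

end
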